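import Literature.Geometry.Kaehler.ComplexTorusRealMultiplicationLefschetzGroupConnected
import Literature.Geometry.Kaehler.ComplexTorusMaximalRealMultiplicationHodgeLieAlgebra
import HarnessLib

/-!
# Milne 1999 §2, «simple abelian variety of type I», the «Group» column WITH THE EMBEDDINGS: in a Darboux
# eigenframe of `V_ℂ = ⊕_{σ : F → ℂ} V_σ` the group `S(X)(ℂ)` IS `∏_{σ : F → ℂ} Sp_{2g/f}(ℂ)` —
# `S(X)(ℂ) = P · diag_σ(Sp_{2n}(ℂ)) · P⁻¹`, `2n · [F : ℚ] = 2g`, the `σ`-th block acting on `V_σ`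
# («`(V(A), φ) ⊗_k k^al = ⊕_{σ:F→k^al} (V_σ, φ_σ)` and `S(A)_{k^al} ≅ ∏_{σ:F→k^al} Sp(φ_σ)`»;
# Summary table: «I ∣ Sp_{2g/f} … The group `S(A)_{/k^al}` is isomorphic to `f` copies of the group listed»)

Layer `Literature/Geometry/Kaehler`, namespace `Literature.Geometry.Kaehler.ComplexTorus`; lane `lit-hodgefound`
(Track 2 foundations library), Layer A4 (Lefschetz groups); prover seat `lit-hodgefound-p17`, generation 61,
self-proposed row g61-#1.  Sequel BY NAME of skel-4's `ComplexTorusRealMultiplicationLefschetzGroupConnected` (A4-93: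
`S(X)(ℂ) = P · ∏_q Sp(H_q) · P⁻¹` INSIDE the proof of `isPrime_vanishingIdealC_lefschetzGroupC_of_rosati_eq_self`, the
blocks `q` being the classes of an eigenbasis under «same character» and `Sp(H_q)` a `GL`-conjugate of a standard group;
that file records as NOT done «the identification of the classes `q` with the embeddings `σ : F → ℝ` and of `Sp(H_q)`
with `Sp(φ_σ)` … as printed»), which is what this file supplies: the blocks are indexed by the complex embeddings
`σ : K →+* ℂ` of the multiplying field, all of the same size `2n = 2g/[K:ℚ]` (Milne's Prop. 2.1, the tree's
`finrank_iInf_eigenspace_toLin'_map_mul_finrank`), the `σ`-th block is the matrix of the restriction to the eigenspace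
`V_σ` in a Darboux basis of `(V_σ, E_σ)`, and each block group is literally the standard `Sp_{2n}(ℂ) = symplecticGroupC`.
Consumed BY NAME: p13's eigenspaces `V_σ = ⨅_a ker((f a) ⊗ 1 − σ(a))` with `V_ℂ = ⊕_σ V_σ` and their common dimension
(`ComplexTorusEndomorphismFieldEigenspaces`), p17's `V_σ ⊥_E V_τ` and the nondegeneracy of `E_σ`
(`ComplexTorusEndomorphismFieldEigenspacesSymplectic`, `ComplexTorusMaximalRealMultiplicationHodgeLieAlgebra` §0), the
symplectic basis theorem `Literature.Geometry.Symplectic.exists_symplecticBasis`, and skel-4 ∕ p22 ∕ p36's transport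
vocabulary `symplecticGroupC`, `reindexSLC`, `conjGLC`, `sigmaBlockDiagSL`, `conj_symplectic_iff`, `lefschetzGroupC`,
`mem_lefschetzGroupC_iff`.  THEOREMS ONLY (no definition, no instance, no notation, no named fact; D-0026, net debt 0).

## Sources, VERBATIM (held text `paper:doi-10-1215-s0012-7094-99-09620-5`, PDF page = printed page − 638)

* J. S. Milne, *Lefschetz classes on abelian varieties*, Duke Math. J. **96** (1999) 639–675, §2 «Simple abelian
  variety of type I», p. 648 (p0010 L37–L63): «In this case `E = F`. Let `D` be an ample divisor on `A`, and let
  `φ : V(A) × V(A) → F ⊗_ℚ k` be the skew-symmetric form such that `Tr_{F⊗ℚk/k} ∘ φ = e_D`. […] Corresponding to the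
  decomposition `F ⊗_ℚ k = ∏ᵢ Fᵢ` […] `(V(A), φ) = (V₁, φ₁) ⊕ ⋯ ⊕ (V_t, φ_t)` […] Here `φᵢ` is a nondegenerate
  skew-symmetric form on the `Fᵢ`-vector space `Vᵢ`. […] Moreover, `S(A) = S₁ × ⋯ × S_t`, `Sᵢ = Res_{Fᵢ/k} Sp(φᵢ)`»;
  p. 649 (p0011 L8–L29): «Similarly, if `F ⊗_ℚ k^al = ∏_{σ:F→k^al} k_σ`, `k_σ = k^al`, is the decomposition of
  `F ⊗_ℚ k^al` into a product of fields, then `(V(A), φ) ⊗_k k^al = ⊕_{σ:F→k^al} (V_σ, φ_σ)`,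
  `(V_σ, φ_σ) = (V(A), φ) ⊗_{F,σ} k^al` and `S(A)_{k^al} ≅ ∏_{σ:F→k^al} Sp(φ_σ)`»; Prop. 2.1 (p. 646): «`V(A)` is a free
  `L ⊗_ℚ k`-module of rank `2 dim A/[L:ℚ]`»; Summary, p. 652 (p0014 L5–L12, L62): «Type ∣ Group ∣ Semisimple ∣ Connected ∣
  Dimension ∣ Rank — I ∣ `Sp_{2g/f}` ∣ Yes ∣ Yes ∣ `2g²/f + g` ∣ `g` […] The group `S(A)_{/k^al}` is isomorphic to `f`
  copies of the group listed in the second column.»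
* D. McDuff, D. Salamon, *Introduction to Symplectic Topology*, 3rd ed. (2017), Thm. 2.1.3 (symplectic bases; the
  tree's `exists_symplecticBasis`), Lemma 2.1.6 area («`Sp(2n) ⊂ SL(2n)`»; Mathlib `SymplecticGroup.det_eq_one`).
* H. Lange, *Abelian Varieties over the Complex Numbers* (2023), §2.4.1 (Rosati involution `A' = G⁻¹ ᵗA G`), Thm.
  2.6.5 (a) (type I: «`F` is a totally real number field and the anti-involution is the identity»), §7.2.4 Exercise
  (4) (`Lf(X)`).

## The argument, and what is proved (pure matrix algebra over `ℂ`; CONCRETE torus level `X = E/Φ(ℤ^ι)`)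

DATA: a number field `K` acting through `f : K →ₐ[ℚ] M_ι(ℚ)` on `V = ℚ^ι`, a rational `G` with `ᵗG = −G`,
`det G ≠ 0`, and `f(K)` `E`-SYMMETRIC: `ᵗ(f a) G = G (f a)` (the Rosati involution fixes `f(K)` pointwise — real
multiplication; for a polarisation this forces `K` totally real, `forall_rosati_algHom_eq_iff_isTotallyReal`).
`V_σ ⊆ V_ℂ = ℂ^ι` is the simultaneous eigenspace of `f(K) ⊗ 1` for the character `σ : K →+* ℂ`.
* §1 A DARBOUX EIGENFRAME **`exists_darbouxEigenframe`**: there are `n`, `e : ι ≃ Σ_{σ : K →+* ℂ} (Fin n ⊕ Fin n)` and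
  `P ∈ GL_ι(ℂ)` with `2n · [K:ℚ] = #ι`, every column `P_{·,j}` in `V_{(e j).1}` (so `(f a)_ℂ P = P diag((e j).1 a)`,
  `map_mul_frame_eq_frame_mul_diagonal`), and frame Gram matrix `ᵗP G_ℂ P = diag_σ(J_{2n})` (`J = (0 −1; 1 0)`):
  off-block entries vanish (`V_σ ⊥ V_τ`), in-block entries are those of `J` (a Darboux basis of the nondegenerate
  alternating `E_σ = E_ℂ|V_σ`, all `V_σ` having dimension `2g/[K:ℚ]`, Prop. 2.1) — «`(V(A), φ) ⊗ k^al = ⊕_σ (V_σ, φ_σ)`».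
* §2 IN ANY SUCH FRAME: `M` commutes with `f(K) ⊗ 1` iff `P⁻¹ M P` has vanishing off-`σ`-blocks
  (**`forall_mul_map_comm_iff_forall_apply_eq_zero`** — «any `k`-linear map commuting with the action of `F` decomposes
  `α = ⊕ αᵢ`»), and then `ᵗM G_ℂ M = G_ℂ` iff every diagonal block is in `Sp_{2n}(ℂ)`; whence, for a complex torus
  `X = E/Φ(ℤ^ι)` with `End_ℚ(X) = f(K)` (`f.range = endAlgRat Φ`), THE SUBGROUP IDENTITY
  **`lefschetzGroupC_eq_conj_pi_symplecticGroupC`**: `S(X)(ℂ) = P · e⁻¹(diag(∏_{σ} Sp_{2n}(ℂ))) · P⁻¹` in `SL_ι(ℂ)`, and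
  with only `f(K) ⊆ End_ℚ(X)` the inclusion `lefschetzGroupC_le_conj_pi_symplecticGroupC` (`S(X)(ℂ) ⊆ ∏_σ Sp(V_σ, E_σ)`).
* §3 «`S(A)_{k^al} ≅ ∏_{σ:F→k^al} Sp(φ_σ)`», «`f` copies of `Sp_{2g/f}`»:
  **`exists_mulEquiv_pi_symplecticGroupC_lefschetzGroupC`** — an isomorphism
  `ψ : (Π_{σ : K →+* ℂ} Sp_{2n}(ℂ)) ≃* S(X)(ℂ)` with `ψ(A) = P · e⁻¹(diag_σ A_σ) · P⁻¹` and `2n · [K:ℚ] = #ι`, and the bare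
  **`nonempty_lefschetzGroupC_mulEquiv_pi_symplecticGroupC`**.

Faithfulness notes. (i) As everywhere in this lane, Milne's algebraic group `S(A)` enters through its complex points
`S(X)(ℂ) = lefschetzGroupC Φ G ≤ SL_ι(ℂ)` (`k^al = ℂ`). (ii) Milne's `φ_σ` is the `F ⊗_σ ℂ`-bilinear form with
`Tr ∘ φ = e_D`; on `V_σ` the `ℂ`-bilinear `E_ℂ|V_σ` IS `φ_σ` (the other components of `Tr` vanish on `V_σ`), so
`Sp(φ_σ) = Sp(V_σ, E_σ)`, read here in a Darboux basis as the standard `Sp_{2n}(ℂ)`. (iii) The polarised ∕ simple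
type I front-ends (Rosati-fixedness from total reality, `2n·[F:ℚ] = 2g` as `n·[F:ℚ] = g`, `Lf = S`) are the sequel row.

## References

* [Milne1999LefschetzClasses] J. S. Milne, *Lefschetz classes on abelian varieties*, Duke Math. J. 96 (1999)
  639–675: §2 Prop. 2.1, «Simple abelian variety of type I» (p. 648–649), Summary table (p. 652).
* [McDuffSalamon2017] D. McDuff, D. Salamon, *Introduction to Symplectic Topology*, 3rd ed., OUP (2017), Thm. 2.1.3.
* [Lange2023AbelianVarietiesComplex] H. Lange, *Abelian Varieties over the Complex Numbers*, Springer (2023), §2.4.1,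
  Thm. 2.6.5 (a), §7.2.4 Exercise (4).
* [Springer1998] T. A. Springer, *Linear Algebraic Groups*, 2nd ed. (1998), §2.1.4, Exercise 2.2.9 (1)(b).
-/

noncomputable section

open Module Matrix

namespace Literature.Geometry.Kaehler

namespace ComplexTorus

/-! ## §0 Matrix bookkeeping -/

section Bookkeeping

variable {ι : Type*} [Fintype ι]

/-- `(column j of P) · H (column j' of P) = (ᵗP H P)_{jj'}`. [folklore] -/
private theorem transpose_mul_mul_apply_eq_col_dotProduct (P H : Matrix ι ι ℂ) (j j' : ι) :
    (fun k ↦ P k j) ⬝ᵥ (H *ᵥ fun k ↦ P k j') = (Pᵀ * H * P) j j' := by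
  simp only [Matrix.mul_apply, Matrix.transpose_apply, dotProduct, Matrix.mulVec, Finset.sum_mul, Finset.mul_sum]
  rw [Finset.sum_comm]
  exact Finset.sum_congr rfl fun a _ ↦ Finset.sum_congr rfl fun c _ ↦ by ring

/-- `(A P)_{ij} = (A · column j of P)_i`. [folklore] -/
private theorem mul_apply_eq_mulVec_column (A P : Matrix ι ι ℂ) (i j : ι) :
    (A * P) i j = (A *ᵥ fun k ↦ P k j) i := by
  simp only [Matrix.mul_apply, Matrix.mulVec, dotProduct]

variable [DecidableEq ι]

/-- Conjugating a commutation relation into a frame: `M (P D P⁻¹) = (P D P⁻¹) M ⟺ (P⁻¹ M P) D = D (P⁻¹ M P)`.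
[folklore] -/
private theorem mul_conjFrame_comm_iff {P : Matrix ι ι ℂ} (hP : IsUnit P.det) (M D : Matrix ι ι ℂ) :
    M * (P * D * P⁻¹) = P * D * P⁻¹ * M ↔ P⁻¹ * M * P * D = D * (P⁻¹ * M * P) := by
  constructor
  · intro h
    have h1 := congrArg (fun X : Matrix ι ι ℂ ↦ P⁻¹ * X * P) h
    simp only [Matrix.mul_assoc] at h1
    rw [Matrix.nonsing_inv_mul _ hP, Matrix.mul_one, Matrix.nonsing_inv_mul_cancel_left _ _ hP] at h1
    simpa only [Matrix.mul_assoc] using h1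
  · intro h
    have h1 := congrArg (fun X : Matrix ι ι ℂ ↦ P * X * P⁻¹) h
    simp only [Matrix.mul_assoc] at h1
    rw [Matrix.mul_nonsing_inv_cancel_left _ _ hP, Matrix.mul_nonsing_inv _ hP, Matrix.mul_one] at h1
    simpa only [Matrix.mul_assoc] using h1

omit [DecidableEq ι] in
/-- `B diag(d) = diag(d) B ⟺ (d_j − d_i) B_{ij} = 0` for all `i, j`. [folklore] -/
private theorem mul_diagonal_comm_iff' [DecidableEq ι] (B : Matrix ι ι ℂ) (d : ι → ℂ) :
    B * Matrix.diagonal d = Matrix.diagonal d * B ↔ ∀ i j, (d j - d i) * B i j = 0 := by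
  rw [← Matrix.ext_iff]
  refine forall₂_congr fun i j ↦ ?_
  rw [Matrix.mul_diagonal, Matrix.diagonal_mul, sub_mul]
  constructor
  · intro h; rw [mul_comm (d j), h, mul_comm, sub_self]
  · intro h; rw [mul_comm, ← sub_eq_zero, ← mul_comm (B i j) (d i), ← mul_comm (d i)]; linear_combination h

end Bookkeeping

/-! ## §1 A Darboux eigenframe of `V_ℂ = ⊕_σ V_σ` for an `E`-symmetric number field `f(K) ⊆ M_ι(ℚ)` -/

section Frame

variable {ι : Type*} [Fintype ι] [DecidableEq ι] {K : Type*} [Field K] [NumberField K] (f : K →ₐ[ℚ] Matrix ι ι ℚ)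

/-- **A DARBOUX EIGENFRAME** («`(V(A), φ) ⊗_k k^al = ⊕_{σ:F→k^al} (V_σ, φ_σ)` … `φ_σ` is a nondegenerate skew-symmetric
form»; Prop. 2.1 «free of rank `2 dim A/[L:ℚ]`»): for a number field `K` acting on `ℚ^ι` through `f` and a rational
`G` with `ᵗG = −G`, `det G ≠ 0`, `ᵗ(f a) G = G (f a)` for all `a`, there are `n`, a relabelling
`e : ι ≃ Σ_{σ : K →+* ℂ} (Fin n ⊕ Fin n)` and an invertible complex `P` such that `2n · [K:ℚ] = #ι`, the `j`-th column of
`P` lies in the eigenspace `V_{(e j).1}`, and the frame Gram matrix `ᵗP G_ℂ P` vanishes between different `σ`-blocks and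
equals the standard `J_{2n} = (0 −1; 1 0)` on each `σ`-block. [cite: Milne1999LefschetzClasses, §2 Prop. 2.1 and «Simple abelian variety of type I» (p. 648–649)]
[cite: McDuffSalamon2017, Thm. 2.1.3] -/
theorem exists_darbouxEigenframe {G : Matrix ι ι ℚ} (hGt : Gᵀ = -G) (hG : G.det ≠ 0)
    (hsym : ∀ a : K, (f a)ᵀ * G = G * f a) :
    ∃ (n : ℕ) (e : ι ≃ Σ _ : (K →+* ℂ), Fin n ⊕ Fin n) (P : Matrix ι ι ℂ), IsUnit P.det ∧
      2 * n * finrank ℚ K = Fintype.card ι ∧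
      (∀ j : ι, (fun i ↦ P i j) ∈
        ⨅ a : K, Module.End.eigenspace (Matrix.toLin' ((f a).map (algebraMap ℚ ℂ))) ((e j).1 a)) ∧
      (∀ p q : Σ _ : (K →+* ℂ), Fin n ⊕ Fin n, p.1 ≠ q.1 →
        (Pᵀ * G.map (algebraMap ℚ ℂ) * P) (e.symm p) (e.symm q) = 0) ∧
      ∀ (σ : K →+* ℂ) (x y : Fin n ⊕ Fin n),
        (Pᵀ * G.map (algebraMap ℚ ℂ) * P) (e.symm ⟨σ, x⟩) (e.symm ⟨σ, y⟩) = Matrix.J (Fin n) ℂ x y := by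
  classical
  set Gc : Matrix ι ι ℂ := G.map (algebraMap ℚ ℂ) with hGc
  have hGct : Gcᵀ = -Gc := by
    rw [hGc, ← Matrix.transpose_map, hGt, Matrix.map_neg _ (map_neg (algebraMap ℚ ℂ))]
  -- the eigenspaces `W σ = V_σ` form an internal direct sum
  set W : (K →+* ℂ) → Submodule ℂ (ι → ℂ) := fun σ ↦
    ⨅ a : K, Module.End.eigenspace (Matrix.toLin' ((f a).map (algebraMap ℚ ℂ))) (σ a) with hW
  have hI : DirectSum.IsInternal W :=
    DirectSum.isInternal_submodule_of_iSupIndep_of_iSup_eq_top (iSupIndep_iInf_eigenspace_toLin'_map f)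
      (iSup_iInf_eigenspace_toLin'_map_eq_top f)
  -- the forms `E_σ = E_ℂ|V_σ`: alternating and nondegenerate
  let B : ∀ σ : K →+* ℂ, LinearMap.BilinForm ℂ (W σ) := fun σ ↦ (Matrix.toBilin' Gc).restrict (W σ)
  have hBapp : ∀ σ (u v : W σ), B σ u v = (u : ι → ℂ) ⬝ᵥ (Gc *ᵥ (v : ι → ℂ)) := fun σ u v ↦ by
    simp only [B, LinearMap.BilinForm.restrict_apply, LinearMap.domRestrict_apply, Matrix.toBilin'_apply']
  have hskew : ∀ u v : ι → ℂ, u ⬝ᵥ (Gc *ᵥ v) = -(v ⬝ᵥ (Gc *ᵥ u)) := fun u v ↦ by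
    conv_lhs => rw [Matrix.dotProduct_mulVec, ← Matrix.mulVec_transpose, dotProduct_comm, hGct, Matrix.neg_mulVec,
      dotProduct_neg]
  have hBalt : ∀ σ, (B σ).IsAlt := fun σ u ↦ by
    rw [hBapp]
    have h := hskew (u : ι → ℂ) (u : ι → ℂ)
    have h2 : (u : ι → ℂ) ⬝ᵥ (Gc *ᵥ (u : ι → ℂ)) + (u : ι → ℂ) ⬝ᵥ (Gc *ᵥ (u : ι → ℂ)) = 0 := by
      linear_combination h
    exact add_self_eq_zero.1 h2
  have hBnd : ∀ σ, (B σ).Nondegenerate := fun σ ↦ by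
    have hrefl : LinearMap.IsRefl (B σ) := fun u v huv ↦ by
      rw [hBapp] at huv ⊢
      rw [hskew, huv, neg_zero]
    refine hrefl.nondegenerate_iff_separatingLeft.2 fun u hu ↦ Subtype.ext ?_
    exact eq_zero_of_forall_dotProduct_mulVec_eq_zero_of_mem_iInf_eigenspace' f hG hsym σ u.2 fun y hy ↦ by
      rw [← hBapp σ u ⟨y, hy⟩]; exact hu ⟨y, hy⟩
  -- Darboux bases of every `V_σ`
  have hex : ∀ σ : K →+* ℂ, ∃ (m : ℕ) (b : Basis (Fin m ⊕ Fin m) ℂ (W σ)),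
      (∀ i j, B σ (b (Sum.inl i)) (b (Sum.inl j)) = 0) ∧ (∀ i j, B σ (b (Sum.inr i)) (b (Sum.inr j)) = 0) ∧
        ∀ i j, B σ (b (Sum.inl i)) (b (Sum.inr j)) = if i = j then 1 else 0 := fun σ ↦
    Literature.Geometry.Symplectic.exists_symplecticBasis (B σ) (hBalt σ) (hBnd σ)
  choose m b hll hrr hlr using hex
  -- all `V_σ` have the same dimension `2g/[K:ℚ]` (Prop. 2.1), so all `m σ` agree
  have hdim : ∀ σ, finrank ℂ (W σ) * finrank ℚ K = Fintype.card ι := fun σ ↦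
    finrank_iInf_eigenspace_toLin'_map_mul_finrank f σ
  have hm2 : ∀ σ, finrank ℂ (W σ) = m σ + m σ := fun σ ↦ by
    rw [finrank_eq_card_basis (b σ), Fintype.card_sum, Fintype.card_fin]
  obtain ⟨σ₀⟩ := (inferInstance : Nonempty (K →+* ℂ))
  set n : ℕ := m σ₀ with hn
  have hK : 0 < finrank ℚ K := finrank_pos
  have hmn : ∀ σ, m σ = n := fun σ ↦ by
    have h1 := hdim σ
    rw [← hdim σ₀, hm2, hm2] at h1
    have h2 := Nat.eq_of_mul_eq_mul_right hK h1
    omega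
  have hcard : 2 * n * finrank ℚ K = Fintype.card ι := by
    rw [← hdim σ₀, hm2]; ring
  -- uniform Darboux bases `c σ : Fin n ⊕ Fin n → V_σ`, with the order of the two halves swapped (Gram matrix `+J`)
  let ε : ∀ σ, Fin (m σ) ⊕ Fin (m σ) ≃ Fin n ⊕ Fin n := fun σ ↦
    (Equiv.sumComm _ _).trans (Equiv.sumCongr (finCongr (hmn σ)) (finCongr (hmn σ)))
  let c : ∀ σ, Basis (Fin n ⊕ Fin n) ℂ (W σ) := fun σ ↦ (b σ).reindex (ε σ)
  have hc_inl : ∀ σ i, c σ (Sum.inl i) = b σ (Sum.inr (i.cast (hmn σ).symm)) := fun σ i ↦ by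
    simp only [c, ε, Basis.reindex_apply, Equiv.symm_trans_apply, Equiv.sumCongr_symm, Equiv.sumCongr_apply,
      Sum.map_inl, finCongr_symm_apply, Equiv.sumComm_symm, Equiv.sumComm_apply, Sum.swap_inl]
  have hc_inr : ∀ σ i, c σ (Sum.inr i) = b σ (Sum.inl (i.cast (hmn σ).symm)) := fun σ i ↦ by
    simp only [c, ε, Basis.reindex_apply, Equiv.symm_trans_apply, Equiv.sumCongr_symm, Equiv.sumCongr_apply,
      Sum.map_inr, finCongr_symm_apply, Equiv.sumComm_symm, Equiv.sumComm_apply, Sum.swap_inr]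
  have hgramJ : ∀ σ (x y : Fin n ⊕ Fin n), B σ (c σ x) (c σ y) = Matrix.J (Fin n) ℂ x y := by
    intro σ x y
    have hcast : ∀ i j : Fin n, (i.cast (hmn σ).symm = j.cast (hmn σ).symm) ↔ i = j := fun i j ↦
      (Fin.cast_injective _).eq_iff
    rcases x with i | i <;> rcases y with j | j
    · rw [hc_inl, hc_inl, hrr, Matrix.J, Matrix.fromBlocks_apply₁₁, Matrix.zero_apply]
    · rw [hc_inl, hc_inr, Matrix.J, Matrix.fromBlocks_apply₁₂, Matrix.neg_apply, Matrix.one_apply, ← (hBalt σ).neg_eq,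
        hlr]
      simp only [hcast, eq_comm]
    · rw [hc_inr, hc_inl, hlr, Matrix.J, Matrix.fromBlocks_apply₂₁, Matrix.one_apply]
      simp only [hcast]
    · rw [hc_inr, hc_inr, hll, Matrix.J, Matrix.fromBlocks_apply₂₂, Matrix.zero_apply]
  -- the collected basis, the relabelling `e`, the frame `P`
  let cb : Basis (Σ _ : (K →+* ℂ), Fin n ⊕ Fin n) ℂ (ι → ℂ) := hI.collectedBasis c
  have hcb : ∀ p, cb p = (c p.1 p.2 : ι → ℂ) := fun p ↦ by
    rw [DirectSum.IsInternal.collectedBasis_coe]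
  let e : ι ≃ Σ _ : (K →+* ℂ), Fin n ⊕ Fin n := (Pi.basisFun ℂ ι).indexEquiv cb
  let v : Basis ι ℂ (ι → ℂ) := cb.reindex e.symm
  let P : Matrix ι ι ℂ := (Pi.basisFun ℂ ι).toMatrix v
  have hP : ∀ i j, P i j = (c (e j).1 (e j).2 : ι → ℂ) i := fun i j ↦ by
    simp only [P, v, Module.Basis.toMatrix_apply, Pi.basisFun_repr, Module.Basis.reindex_apply, Equiv.symm_symm, hcb]
  have hPcol : ∀ j, (fun i ↦ P i j) = (c (e j).1 (e j).2 : ι → ℂ) := fun j ↦ funext fun i ↦ hP i j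
  have hPu : IsUnit P.det := by
    letI := (Pi.basisFun ℂ ι).invertibleToMatrix v
    exact Matrix.isUnit_det_of_invertible P
  refine ⟨n, e, P, hPu, hcard, fun j ↦ ?_, fun p q hpq ↦ ?_, fun σ x y ↦ ?_⟩
  · rw [hPcol]; exact (c (e j).1 (e j).2).2
  · rw [← transpose_mul_mul_apply_eq_col_dotProduct, hPcol, hPcol]
    have hp := (c (e (e.symm p)).1 (e (e.symm p)).2).2
    have hq := (c (e (e.symm q)).1 (e (e.symm q)).2).2
    simp only [Equiv.apply_symm_apply] at hp hq ⊢
    exact dotProduct_mulVec_eq_zero_of_mem_iInf_eigenspace_of_ne f hsym hpq hp hq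
  · rw [← transpose_mul_mul_apply_eq_col_dotProduct, hPcol, hPcol, Equiv.apply_symm_apply, Equiv.apply_symm_apply]
    dsimp only
    rw [← hgramJ σ x y, hBapp]

/-- **In an eigenframe, `f(K) ⊗ 1` is diagonal**: if every column `P_{·,j}` lies in `V_{(e j).1}`, then
`(f a)_ℂ · P = P · diag_j((e j).1 a)`. [cite: Milne1999LefschetzClasses, §2 Preliminaries (p. 646: `V(A) = ⊕ V_i`, `V_i = e_i V`)] -/
theorem map_mul_frame_eq_frame_mul_diagonal {n : ℕ} {e : ι ≃ Σ _ : (K →+* ℂ), Fin n ⊕ Fin n} {P : Matrix ι ι ℂ}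
    (hcol : ∀ j : ι, (fun i ↦ P i j) ∈
      ⨅ a : K, Module.End.eigenspace (Matrix.toLin' ((f a).map (algebraMap ℚ ℂ))) ((e j).1 a)) (a : K) :
    (f a).map (algebraMap ℚ ℂ) * P = P * Matrix.diagonal fun j ↦ (e j).1 a := by
  ext i j
  have h := (Submodule.mem_iInf _).1 (hcol j) a
  rw [Module.End.mem_eigenspace_iff, Matrix.toLin'_apply] at h
  rw [mul_apply_eq_mulVec_column, h, Matrix.mul_diagonal, Pi.smul_apply, smul_eq_mul, mul_comm]

/-! ## §2 In a Darboux eigenframe: centraliser of `f(K)` = block diagonal, `Sp(E)` = blockwise `Sp_{2n}` -/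

/-- **«Any `k`-linear map commuting with the action of `F` decomposes into `α = α₁ ⊕ ⋯ ⊕ α_t`»**: `M` commutes with
every `(f a) ⊗ 1` iff `P⁻¹ M P` vanishes between different `σ`-blocks of the eigenframe.
[cite: Milne1999LefschetzClasses, §2 Preliminaries (p. 646)] -/
theorem forall_mul_map_comm_iff_forall_apply_eq_zero {n : ℕ} {e : ι ≃ Σ _ : (K →+* ℂ), Fin n ⊕ Fin n}
    {P : Matrix ι ι ℂ} (hP : IsUnit P.det)
    (hcol : ∀ j : ι, (fun i ↦ P i j) ∈
      ⨅ a : K, Module.End.eigenspace (Matrix.toLin' ((f a).map (algebraMap ℚ ℂ))) ((e j).1 a)) (M : Matrix ι ι ℂ) :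
    (∀ a : K, M * (f a).map (algebraMap ℚ ℂ) = (f a).map (algebraMap ℚ ℂ) * M) ↔
      ∀ p q : Σ _ : (K →+* ℂ), Fin n ⊕ Fin n, p.1 ≠ q.1 → (P⁻¹ * M * P) (e.symm p) (e.symm q) = 0 := by
  have hfa : ∀ a : K, (f a).map (algebraMap ℚ ℂ) = P * (Matrix.diagonal fun j ↦ (e j).1 a) * P⁻¹ := fun a ↦ by
    rw [← map_mul_frame_eq_frame_mul_diagonal f hcol a, Matrix.mul_nonsing_inv_cancel_right _ _ hP]
  simp_rw [hfa, mul_conjFrame_comm_iff hP, mul_diagonal_comm_iff']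
  constructor
  · intro h p q hpq
    obtain ⟨a, ha⟩ := DFunLike.ne_iff.1 hpq.symm
    have h1 := h a (e.symm p) (e.symm q)
    rw [Equiv.apply_symm_apply, Equiv.apply_symm_apply] at h1
    exact (mul_eq_zero.1 h1).resolve_left (sub_ne_zero.2 ha)
  · intro h a i j
    by_cases hij : (e i).1 = (e j).1
    · rw [hij, sub_self, zero_mul]
    · have h1 := h (e i) (e j) hij
      rw [Equiv.symm_apply_apply, Equiv.symm_apply_apply] at h1
      rw [h1, mul_zero]

variable [DecidableEq (K →+* ℂ)]

omit [DecidableEq ι] [NumberField K] in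
/-- The frame Gram matrix of a Darboux eigenframe, as one matrix: `ᵗP G_ℂ P = e⁻¹(diag_σ J_{2n})`.
[cite: Milne1999LefschetzClasses, §2 «Simple abelian variety of type I» (`(V(A), φ) ⊗ k^al = ⊕_σ (V_σ, φ_σ)`)] -/
theorem frameGram_eq_submatrix_blockDiagonal_J {n : ℕ} {e : ι ≃ Σ _ : (K →+* ℂ), Fin n ⊕ Fin n}
    {P : Matrix ι ι ℂ} {G : Matrix ι ι ℚ}
    (hoff : ∀ p q : Σ _ : (K →+* ℂ), Fin n ⊕ Fin n, p.1 ≠ q.1 →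
      (Pᵀ * G.map (algebraMap ℚ ℂ) * P) (e.symm p) (e.symm q) = 0)
    (hin : ∀ (σ : K →+* ℂ) (x y : Fin n ⊕ Fin n),
      (Pᵀ * G.map (algebraMap ℚ ℂ) * P) (e.symm ⟨σ, x⟩) (e.symm ⟨σ, y⟩) = Matrix.J (Fin n) ℂ x y) :
    Pᵀ * G.map (algebraMap ℚ ℂ) * P =
      (Matrix.blockDiagonal' fun _ : K →+* ℂ ↦ Matrix.J (Fin n) ℂ).submatrix e e := by
  ext i j
  obtain ⟨⟨σ, x⟩, rfl⟩ := e.symm.surjective i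
  obtain ⟨⟨τ, y⟩, rfl⟩ := e.symm.surjective j
  rw [Matrix.submatrix_apply, Equiv.apply_symm_apply, Equiv.apply_symm_apply]
  by_cases hστ : σ = τ
  · subst hστ
    rw [hin, Matrix.blockDiagonal'_apply_eq]
  · rw [hoff ⟨σ, x⟩ ⟨τ, y⟩ hστ, Matrix.blockDiagonal'_apply_ne _ _ _ hστ]

omit [Fintype ι] [DecidableEq ι] [NumberField K] [DecidableEq (K →+* ℂ)] in
/-- Relabelling both indices along an equivalence is injective on square matrices. [folklore] -/
private theorem submatrix_equiv_eq_iff {κ : Type*} (e : ι ≃ κ) {A A' : Matrix κ κ ℂ} :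
    A.submatrix e e = A'.submatrix e e ↔ A = A' := by
  refine ⟨fun h ↦ ?_, fun h ↦ by rw [h]⟩
  have h2 := congrArg (fun Y : Matrix ι ι ℂ ↦ Y.submatrix e.symm e.symm) h
  simpa only [Matrix.submatrix_submatrix, Equiv.self_comp_symm, Matrix.submatrix_id_id] using h2

/-- **IN A DARBOUX EIGENFRAME, `{M ∈ SL_ι(ℂ) ∣ ᵗM G_ℂ M = G_ℂ, M (f a) = (f a) M ∀a} = P · e⁻¹(diag ∏_σ Sp_{2n}(ℂ)) · P⁻¹`**:
an `M ∈ SL_ι(ℂ)` preserves `E_ℂ` and commutes with `f(K) ⊗ 1` iff `P⁻¹ M P`, relabelled along `e`, is block diagonal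
with every `σ`-block in the standard `Sp_{2n}(ℂ)` («`C(A) = ∏ Cᵢ`, `Cᵢ = End_{Fᵢ}(Vᵢ)` … `S(A)_{k^al} ≅ ∏_σ Sp(φ_σ)`»).
[cite: Milne1999LefschetzClasses, §2 «Simple abelian variety of type I» (p. 648–649)] [cite: Springer1998, Exercise 2.2.9 (1)(b)] -/
theorem mem_conj_pi_symplecticGroupC_iff {n : ℕ} {e : ι ≃ Σ _ : (K →+* ℂ), Fin n ⊕ Fin n} {P : Matrix ι ι ℂ}
    (hP : IsUnit P.det) {G : Matrix ι ι ℚ}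
    (hcol : ∀ j : ι, (fun i ↦ P i j) ∈
      ⨅ a : K, Module.End.eigenspace (Matrix.toLin' ((f a).map (algebraMap ℚ ℂ))) ((e j).1 a))
    (hoff : ∀ p q : Σ _ : (K →+* ℂ), Fin n ⊕ Fin n, p.1 ≠ q.1 →
      (Pᵀ * G.map (algebraMap ℚ ℂ) * P) (e.symm p) (e.symm q) = 0)
    (hin : ∀ (σ : K →+* ℂ) (x y : Fin n ⊕ Fin n),
      (Pᵀ * G.map (algebraMap ℚ ℂ) * P) (e.symm ⟨σ, x⟩) (e.symm ⟨σ, y⟩) = Matrix.J (Fin n) ℂ x y)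
    (M : SpecialLinearGroup ι ℂ) :
    M ∈ (((Subgroup.pi Set.univ fun _ : K →+* ℂ ↦ symplecticGroupC (Fin n)).map
        (sigmaBlockDiagSL (fun _ : K →+* ℂ ↦ Fin n ⊕ Fin n) ℂ)).map (reindexSLC e).symm.toMonoidHom).map
        (conjGLC P hP).toMonoidHom ↔
      (M : Matrix ι ι ℂ)ᵀ * G.map (algebraMap ℚ ℂ) * M = G.map (algebraMap ℚ ℂ) ∧
        ∀ a : K, (M : Matrix ι ι ℂ) * (f a).map (algebraMap ℚ ℂ) = (f a).map (algebraMap ℚ ℂ) * M := by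
  rw [Subgroup.mem_map_equiv, Subgroup.mem_map_equiv, MulEquiv.symm_symm]
  set Gc : Matrix ι ι ℂ := G.map (algebraMap ℚ ℂ) with hGc
  set bdJ : Matrix (Σ _ : (K →+* ℂ), Fin n ⊕ Fin n) (Σ _ : (K →+* ℂ), Fin n ⊕ Fin n) ℂ :=
    Matrix.blockDiagonal' fun _ : K →+* ℂ ↦ Matrix.J (Fin n) ℂ with hbdJ
  have hH : Pᵀ * Gc * P = bdJ.submatrix e e := frameGram_eq_submatrix_blockDiagonal_J hoff hin
  -- `B = P⁻¹ M P` and its relabelling `N`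
  set B : Matrix ι ι ℂ := P⁻¹ * (M : Matrix ι ι ℂ) * P with hB
  set N : SpecialLinearGroup (Σ _ : (K →+* ℂ), Fin n ⊕ Fin n) ℂ := reindexSLC e ((conjGLC P hP).symm M) with hN
  have hNB : (N : Matrix _ _ ℂ) = B.submatrix e.symm e.symm := by rw [hN, coe_reindexSLC, coe_conjGLC_symm]
  have hBN : B = (N : Matrix _ _ ℂ).submatrix e e := by
    rw [hNB]; simp only [Matrix.submatrix_submatrix, Equiv.symm_comp_self, Matrix.submatrix_id_id]
  have hMB : (M : Matrix ι ι ℂ) = P * B * P⁻¹ := by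
    rw [hB, show P * (P⁻¹ * (M : Matrix ι ι ℂ) * P) * P⁻¹ = P * P⁻¹ * (M : Matrix ι ι ℂ) * (P * P⁻¹) by
      simp only [Matrix.mul_assoc], Matrix.mul_nonsing_inv _ hP, Matrix.one_mul, Matrix.mul_one]
  -- (1) the symplectic condition in the frame
  have hsymp_iff : (M : Matrix ι ι ℂ)ᵀ * Gc * M = Gc ↔ (N : Matrix _ _ ℂ)ᵀ * bdJ * (N : Matrix _ _ ℂ) = bdJ := by
    rw [hMB, conj_symplectic_iff hP, hH, hBN, show ((N : Matrix _ _ ℂ).submatrix ⇑e ⇑e)ᵀ =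
      (N : Matrix _ _ ℂ)ᵀ.submatrix e e from (Matrix.transpose_submatrix _ _ _).symm,
      Matrix.submatrix_mul_equiv, Matrix.submatrix_mul_equiv, submatrix_equiv_eq_iff]
  -- (2) the commutation condition in the frame
  have hcomm_iff : (∀ a : K, (M : Matrix ι ι ℂ) * (f a).map (algebraMap ℚ ℂ) = (f a).map (algebraMap ℚ ℂ) * M) ↔
      ∀ p q : Σ _ : (K →+* ℂ), Fin n ⊕ Fin n, p.1 ≠ q.1 → (N : Matrix _ _ ℂ) p q = 0 := by
    rw [forall_mul_map_comm_iff_forall_apply_eq_zero f hP hcol]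
    refine forall₃_congr fun p q _ ↦ ?_
    rw [hNB, Matrix.submatrix_apply]
  rw [hsymp_iff, hcomm_iff]
  constructor
  · -- `P · ∏ Sp · P⁻¹ ⊆ {symplectic, commuting}`
    intro hmem
    obtain ⟨A, hA, hAN⟩ := Subgroup.mem_map.1 hmem
    have hNA : (N : Matrix _ _ ℂ) = Matrix.blockDiagonal' fun σ ↦
        ((A σ : SpecialLinearGroup (Fin n ⊕ Fin n) ℂ) : Matrix (Fin n ⊕ Fin n) (Fin n ⊕ Fin n) ℂ) := by
      rw [← hAN, coe_sigmaBlockDiagSL]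
    have hAσ : ∀ σ, ((A σ : SpecialLinearGroup (Fin n ⊕ Fin n) ℂ) : Matrix _ _ ℂ)ᵀ * Matrix.J (Fin n) ℂ *
        ((A σ : SpecialLinearGroup (Fin n ⊕ Fin n) ℂ) : Matrix _ _ ℂ) = Matrix.J (Fin n) ℂ := fun σ ↦
      mem_symplecticGroupC_iff'.1 ((Subgroup.mem_pi _).1 hA σ (Set.mem_univ σ))
    refine ⟨?_, fun p q hpq ↦ ?_⟩
    · rw [hNA, hbdJ, Matrix.blockDiagonal'_transpose, ← Matrix.blockDiagonal'_mul, ← Matrix.blockDiagonal'_mul]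
      exact congrArg Matrix.blockDiagonal' (funext hAσ)
    · rw [hNA]
      obtain ⟨σ, x⟩ := p
      obtain ⟨τ, y⟩ := q
      exact Matrix.blockDiagonal'_apply_ne (fun σ ↦
        ((A σ : SpecialLinearGroup (Fin n ⊕ Fin n) ℂ) : Matrix (Fin n ⊕ Fin n) (Fin n ⊕ Fin n) ℂ)) x y hpq
  · -- `{symplectic, commuting} ⊆ P · ∏ Sp · P⁻¹`
    rintro ⟨hsymp, hblk⟩
    set Nb : ∀ σ : K →+* ℂ, Matrix (Fin n ⊕ Fin n) (Fin n ⊕ Fin n) ℂ := fun σ ↦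
      Matrix.blockDiag' (N : Matrix (Σ _ : (K →+* ℂ), Fin n ⊕ Fin n) (Σ _ : (K →+* ℂ), Fin n ⊕ Fin n) ℂ) σ with hNb
    have hNeq : (N : Matrix (Σ _ : (K →+* ℂ), Fin n ⊕ Fin n) (Σ _ : (K →+* ℂ), Fin n ⊕ Fin n) ℂ) =
        Matrix.blockDiagonal' Nb := eq_blockDiagonal'_blockDiag'_of_apply_eq_zero hblk
    have hblocks : ∀ σ, (Nb σ)ᵀ * Matrix.J (Fin n) ℂ * Nb σ = Matrix.J (Fin n) ℂ := by
      have h := hsymp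
      rw [hNeq, hbdJ, Matrix.blockDiagonal'_transpose, ← Matrix.blockDiagonal'_mul, ← Matrix.blockDiagonal'_mul] at h
      exact fun σ ↦ congrFun (Matrix.blockDiagonal'_injective h) σ
    have hdet : ∀ σ, (Nb σ).det = 1 := fun σ ↦ SymplecticGroup.det_eq_one (SymplecticGroup.mem_iff'.2 (hblocks σ))
    rw [eq_sigmaBlockDiagSL_of_apply_eq_zero hblk hdet]
    exact Subgroup.mem_map.2 ⟨fun σ ↦ ⟨Nb σ, hdet σ⟩,
      (Subgroup.mem_pi _).2 fun σ _ ↦ mem_symplecticGroupC_iff'.2 (hblocks σ), rfl⟩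

end Frame

/-! ## §3 The complex torus: `S(X)(ℂ) = P · e⁻¹(∏_σ Sp_{2n}(ℂ)) · P⁻¹ ≅ ∏_{σ : F → ℂ} Sp_{2g/f}(ℂ)` -/

section Torus

variable {ι : Type*} [Fintype ι] [DecidableEq ι] {E : Type*} [NormedAddCommGroup E] [NormedSpace ℂ E]
  (Φ : (ι → ℝ) ≃L[ℝ] E) {K : Type*} [Field K] [NumberField K] (f : K →ₐ[ℚ] Matrix ι ι ℚ) {G : Matrix ι ι ℚ}

section Frame

variable [DecidableEq (K →+* ℂ)]

/-- **THE SUBGROUP IDENTITY `S(X)(ℂ) = P · e⁻¹(diag ∏_{σ : F → ℂ} Sp_{2n}(ℂ)) · P⁻¹`** for a complex torus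
`X = E/Φ(ℤ^ι)` whose rational endomorphism algebra IS the field `f(K)` (`f.range = End_ℚ(X)`), in any Darboux
eigenframe `(n, e, P)` of an alternating non-degenerate rational `G` for which `f(K)` is `E`-symmetric — Milne's
«`S(A)_{k^al} ≅ ∏_{σ:F→k^al} Sp(φ_σ)`» as an equality of subgroups of `SL_ι(ℂ)`, the `σ`-th factor acting on `V_σ`.
[cite: Milne1999LefschetzClasses, §2 «Simple abelian variety of type I» (p. 648–649) and Summary table (p. 652, «I ∣ Sp_{2g/f}»)]
[cite: Lange2023AbelianVarietiesComplex, §7.2.4 Exercise (4)] -/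
theorem lefschetzGroupC_eq_conj_pi_symplecticGroupC (hfE : f.range = endAlgRat Φ) {n : ℕ}
    {e : ι ≃ Σ _ : (K →+* ℂ), Fin n ⊕ Fin n} {P : Matrix ι ι ℂ} (hP : IsUnit P.det)
    (hcol : ∀ j : ι, (fun i ↦ P i j) ∈
      ⨅ a : K, Module.End.eigenspace (Matrix.toLin' ((f a).map (algebraMap ℚ ℂ))) ((e j).1 a))
    (hoff : ∀ p q : Σ _ : (K →+* ℂ), Fin n ⊕ Fin n, p.1 ≠ q.1 →
      (Pᵀ * G.map (algebraMap ℚ ℂ) * P) (e.symm p) (e.symm q) = 0)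
    (hin : ∀ (σ : K →+* ℂ) (x y : Fin n ⊕ Fin n),
      (Pᵀ * G.map (algebraMap ℚ ℂ) * P) (e.symm ⟨σ, x⟩) (e.symm ⟨σ, y⟩) = Matrix.J (Fin n) ℂ x y) :
    lefschetzGroupC Φ G = (((Subgroup.pi Set.univ fun _ : K →+* ℂ ↦ symplecticGroupC (Fin n)).map
        (sigmaBlockDiagSL (fun _ : K →+* ℂ ↦ Fin n ⊕ Fin n) ℂ)).map (reindexSLC e).symm.toMonoidHom).map
        (conjGLC P hP).toMonoidHom := by
  ext M
  rw [mem_lefschetzGroupC_iff, mem_conj_pi_symplecticGroupC_iff f hP hcol hoff hin]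
  refine and_congr Iff.rfl ⟨fun h a ↦ h _ ?_, fun h A hA ↦ ?_⟩
  · rw [← hfE]; exact f.mem_range_self a
  · rw [← hfE] at hA
    obtain ⟨a, rfl⟩ := (AlgHom.mem_range f).1 hA
    exact h a

/-- **`S(X)(ℂ) ⊆ ∏_{σ : K → ℂ} Sp(V_σ, E_σ)` whenever `f(K) ⊆ End_ℚ(X)`** (an `E`-symmetric subfield, not necessarily
all of the endomorphism algebra): in a Darboux eigenframe of `K`, `S(X)(ℂ) ⊆ P · e⁻¹(diag ∏_σ Sp_{2n}(ℂ)) · P⁻¹`.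
[cite: Milne1999LefschetzClasses, §2 Preliminaries (p. 646: `α = ⊕ αᵢ`, `φ = ⊕ φᵢ`) and §1 (p. 644: `S(A) ⊆ Sp(e_D)` centralising `End⁰(A)`)] -/
theorem lefschetzGroupC_le_conj_pi_symplecticGroupC (hf : ∀ a : K, f a ∈ endAlgRat Φ) {n : ℕ}
    {e : ι ≃ Σ _ : (K →+* ℂ), Fin n ⊕ Fin n} {P : Matrix ι ι ℂ} (hP : IsUnit P.det)
    (hcol : ∀ j : ι, (fun i ↦ P i j) ∈
      ⨅ a : K, Module.End.eigenspace (Matrix.toLin' ((f a).map (algebraMap ℚ ℂ))) ((e j).1 a))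
    (hoff : ∀ p q : Σ _ : (K →+* ℂ), Fin n ⊕ Fin n, p.1 ≠ q.1 →
      (Pᵀ * G.map (algebraMap ℚ ℂ) * P) (e.symm p) (e.symm q) = 0)
    (hin : ∀ (σ : K →+* ℂ) (x y : Fin n ⊕ Fin n),
      (Pᵀ * G.map (algebraMap ℚ ℂ) * P) (e.symm ⟨σ, x⟩) (e.symm ⟨σ, y⟩) = Matrix.J (Fin n) ℂ x y) :
    lefschetzGroupC Φ G ≤ (((Subgroup.pi Set.univ fun _ : K →+* ℂ ↦ symplecticGroupC (Fin n)).map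
        (sigmaBlockDiagSL (fun _ : K →+* ℂ ↦ Fin n ⊕ Fin n) ℂ)).map (reindexSLC e).symm.toMonoidHom).map
        (conjGLC P hP).toMonoidHom := fun M hM ↦ by
  rw [mem_lefschetzGroupC_iff] at hM
  exact (mem_conj_pi_symplecticGroupC_iff f hP hcol hoff hin M).2 ⟨hM.1, fun a ↦ hM.2 _ (hf a)⟩

/-- **MILNE'S «GROUP» COLUMN, TYPE I, WITH THE EMBEDDINGS: `S(X)(ℂ) = P · e⁻¹(diag ∏_{σ : K → ℂ} Sp_{2n}(ℂ)) · P⁻¹`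
with `2n · [K:ℚ] = #ι = 2g`**, for a complex torus `X = E/Φ(ℤ^ι)` with `End_ℚ(X) = f(K)` a field and an alternating
non-degenerate rational `G` for which `f(K)` is `E`-symmetric (pointwise Rosati-fixed): some Darboux eigenframe
exists (§1) and in it the subgroup identity holds — «`S(A)_{k^al} ≅ ∏_{σ:F→k^al} Sp(φ_σ)`», «I ∣ `Sp_{2g/f}` … `f` copies».
[cite: Milne1999LefschetzClasses, §2 Prop. 2.1, «Simple abelian variety of type I» (p. 648–649) and Summary table (p. 652)]
[cite: Lange2023AbelianVarietiesComplex, Thm. 2.6.5 (a) and §7.2.4 Exercise (4)] -/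
theorem exists_frame_lefschetzGroupC_eq_conj_pi_symplecticGroupC (hfE : f.range = endAlgRat Φ) (hGt : Gᵀ = -G)
    (hG : G.det ≠ 0) (hsym : ∀ a : K, (f a)ᵀ * G = G * f a) :
    ∃ (n : ℕ) (e : ι ≃ Σ _ : (K →+* ℂ), Fin n ⊕ Fin n) (P : Matrix ι ι ℂ) (hP : IsUnit P.det),
      2 * n * finrank ℚ K = Fintype.card ι ∧
      (∀ j : ι, (fun i ↦ P i j) ∈
        ⨅ a : K, Module.End.eigenspace (Matrix.toLin' ((f a).map (algebraMap ℚ ℂ))) ((e j).1 a)) ∧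
      Pᵀ * G.map (algebraMap ℚ ℂ) * P = (Matrix.blockDiagonal' fun _ : K →+* ℂ ↦ Matrix.J (Fin n) ℂ).submatrix e e ∧
      lefschetzGroupC Φ G = (((Subgroup.pi Set.univ fun _ : K →+* ℂ ↦ symplecticGroupC (Fin n)).map
        (sigmaBlockDiagSL (fun _ : K →+* ℂ ↦ Fin n ⊕ Fin n) ℂ)).map (reindexSLC e).symm.toMonoidHom).map
        (conjGLC P hP).toMonoidHom := by
  obtain ⟨n, e, P, hP, hcard, hcol, hoff, hin⟩ := exists_darbouxEigenframe f hGt hG hsym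
  exact ⟨n, e, P, hP, hcard, hcol, frameGram_eq_submatrix_blockDiagonal_J hoff hin,
    lefschetzGroupC_eq_conj_pi_symplecticGroupC Φ f hfE hP hcol hoff hin⟩

omit [Fintype ι] [DecidableEq ι] [NumberField K] [DecidableEq (K →+* ℂ)] in
/-- The range of the coordinatewise inclusion `∏_σ Sp_{2n}(ℂ) ↪ ∏_σ SL_{2n}(ℂ)` is the product subgroup. [folklore] -/
private theorem range_compLeft_subtype (n : ℕ) :
    (MonoidHom.compLeft (symplecticGroupC (Fin n)).subtype (K →+* ℂ)).range =
      Subgroup.pi Set.univ fun _ : K →+* ℂ ↦ symplecticGroupC (Fin n) := by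
  ext A
  rw [MonoidHom.mem_range, Subgroup.mem_pi]
  constructor
  · rintro ⟨B, rfl⟩ σ -
    exact (B σ).2
  · intro h
    exact ⟨fun σ ↦ ⟨A σ, h σ (Set.mem_univ σ)⟩, funext fun σ ↦ rfl⟩

/-- **«`S(A)_{k^al} ≅ ∏_{σ:F→k^al} Sp(φ_σ)`» AS AN ISOMORPHISM `ψ : ∏_{σ : K →+* ℂ} Sp_{2n}(ℂ) ≃* S(X)(ℂ)`, `2n·[K:ℚ] = #ι`,
WITH ITS FORMULA `ψ(A) = P · e⁻¹(diag_σ A_σ) · P⁻¹`** in a Darboux eigenframe whose `j`-th column spans, with its block,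
the eigenspace `V_{(e j).1}` — the `σ`-th factor `Sp_{2n}(ℂ) = Sp(V_σ, E_σ)` («the representation of `S(A)` … on `V_σ`»).
[cite: Milne1999LefschetzClasses, §2 «Simple abelian variety of type I» (p. 648–649) and Summary table (p. 652: «`S(A)_{/k^al}` is isomorphic to `f` copies of the group listed»)] -/
theorem exists_mulEquiv_pi_symplecticGroupC_lefschetzGroupC (hfE : f.range = endAlgRat Φ) (hGt : Gᵀ = -G)
    (hG : G.det ≠ 0) (hsym : ∀ a : K, (f a)ᵀ * G = G * f a) :
    ∃ (n : ℕ) (e : ι ≃ Σ _ : (K →+* ℂ), Fin n ⊕ Fin n) (P : Matrix ι ι ℂ)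
      (ψ : ((K →+* ℂ) → symplecticGroupC (Fin n)) ≃* lefschetzGroupC Φ G),
      IsUnit P.det ∧ 2 * n * finrank ℚ K = Fintype.card ι ∧
      (∀ j : ι, (fun i ↦ P i j) ∈
        ⨅ a : K, Module.End.eigenspace (Matrix.toLin' ((f a).map (algebraMap ℚ ℂ))) ((e j).1 a)) ∧
      Pᵀ * G.map (algebraMap ℚ ℂ) * P = (Matrix.blockDiagonal' fun _ : K →+* ℂ ↦ Matrix.J (Fin n) ℂ).submatrix e e ∧
      ∀ A : (K →+* ℂ) → symplecticGroupC (Fin n),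
        ((ψ A : lefschetzGroupC Φ G) : Matrix ι ι ℂ) =
          P * (Matrix.blockDiagonal' fun σ ↦
            ((A σ : SpecialLinearGroup (Fin n ⊕ Fin n) ℂ) : Matrix (Fin n ⊕ Fin n) (Fin n ⊕ Fin n) ℂ)).submatrix e e * P⁻¹ := by
  obtain ⟨n, e, P, hP, hcard, hcol, hH, hS⟩ := exists_frame_lefschetzGroupC_eq_conj_pi_symplecticGroupC Φ f hfE hGt hG hsym
  -- the composite embedding `A ↦ P · e⁻¹(diag A) · P⁻¹`
  let φ : ((K →+* ℂ) → symplecticGroupC (Fin n)) →* SpecialLinearGroup ι ℂ :=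
    (conjGLC P hP).toMonoidHom.comp ((reindexSLC e).symm.toMonoidHom.comp
      ((sigmaBlockDiagSL (fun _ : K →+* ℂ ↦ Fin n ⊕ Fin n) ℂ).comp
        (MonoidHom.compLeft (symplecticGroupC (Fin n)).subtype (K →+* ℂ))))
  have hφinj : Function.Injective φ := by
    refine (conjGLC P hP).injective.comp ((reindexSLC e).symm.injective.comp
      ((sigmaBlockDiagSL_injective (σ := fun _ : K →+* ℂ ↦ Fin n ⊕ Fin n) (R := ℂ)).comp fun A B h ↦ ?_))
    exact funext fun σ ↦ Subtype.ext (congrFun h σ)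
  have hrange : φ.range = lefschetzGroupC Φ G := by
    rw [hS, MonoidHom.range_comp, MonoidHom.range_comp, MonoidHom.range_comp, range_compLeft_subtype]
  refine ⟨n, e, P, (MonoidHom.ofInjective hφinj).trans (MulEquiv.subgroupCongr hrange), hP, hcard, hcol, hH, fun A ↦ ?_⟩
  rw [MulEquiv.trans_apply, MulEquiv.subgroupCongr_apply, MonoidHom.ofInjective_apply]
  simp only [φ, MonoidHom.comp_apply, MulEquiv.coe_toMonoidHom, coe_conjGLC, coe_reindexSLC_symm,
    coe_sigmaBlockDiagSL, MonoidHom.compLeft_apply, Function.comp_def, Subgroup.coe_subtype]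

end Frame

/-- **«THE GROUP `S(A)_{/k^al}` IS ISOMORPHIC TO `f` COPIES OF `Sp_{2g/f}`» (Milne's Summary table, type I), at torus
level: `S(X)(ℂ) ≃* ∏_{σ : K →+* ℂ} Sp_{2n}(ℂ)` with `2n · [K:ℚ] = #ι = 2g`**, for a complex torus `X = E/Φ(ℤ^ι)` whose
rational endomorphism algebra is the field `f(K)`, `E`-symmetric for the alternating non-degenerate rational `G`.
[cite: Milne1999LefschetzClasses, §2 Summary (p. 652) and «Simple abelian variety of type I» (p. 649: `S(A)_{k^al} ≅ ∏_{σ:F→k^al} Sp(φ_σ)`)] -/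
theorem nonempty_lefschetzGroupC_mulEquiv_pi_symplecticGroupC (hfE : f.range = endAlgRat Φ) (hGt : Gᵀ = -G)
    (hG : G.det ≠ 0) (hsym : ∀ a : K, (f a)ᵀ * G = G * f a) :
    ∃ n : ℕ, 2 * n * finrank ℚ K = Fintype.card ι ∧
      Nonempty (lefschetzGroupC Φ G ≃* ((K →+* ℂ) → symplecticGroupC (Fin n))) := by
  classical
  obtain ⟨n, -, -, ψ, -, hcard, -⟩ := exists_mulEquiv_pi_symplecticGroupC_lefschetzGroupC Φ f hfE hGt hG hsym
  exact ⟨n, hcard, ⟨ψ.symm⟩⟩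

end Torus

end ComplexTorus

end Literature.Geometry.Kaehler
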